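import Summits.ValiantsHypothesis.ValiantsHypothesis.Theorems.FeketeSOSFeketeSOSHardPaleyRIPFlatRIPPaleyClique

/-!
# Route FeketeSOS — crux `FeketeSOSHard` (stmt-ValiantsHypothesis-3996), line `paley-rip`,
# stub `stub_paleyFlatRIP`: flat SUM discrepancy ⟺ flat DIFFERENCE (Paley-graph) discrepancy

The engine of the line is equivalent (`…PaleyRIPFlatOfDiscrepancy.lean`, `…FlatRIPConsequences.lean`) to
flat restricted discrepancy of the Paley SUM graph `(χ_p(a+b))`.  The literature (Chung 1994 Conj. 2.2;
Bandeira–Fickus–Mixon–Wong 2013; Bandeira–Mixon–Moreira 2017, `PaleyDiscrepancy` / `PaleyRIP`) speaks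
about the DIFFERENCE pattern `χ_p(a−b)` (Paley graph / Paley ETF).  For FLAT sums the two are the same
statement, because the reflection `b ↦ (p − b) mod p` is a size-preserving bijection of `[0,p)`
(`charSum_reflect` of `…FlatRIPPaleyClique.lean`):

* `charSum_reflect'` — `Σ_{a∈A, b'∈−B} χ_p(a−b') = Σ_{a∈A, b∈B} χ_p(a+b)` (the reflection read backwards);
* `paleySumDiscrepancy_iff_paleyDiffDiscrepancy` — as `∃κ,δ,p₁`-statements with identical exponents:
  `(∀ A,B small ⊆ [0,p): |Σ χ_p(a+b)| ≤ p^{1/2−κ}√(#A#B)) ⟺ (∀ A,B small ⊆ [0,p): |Σ χ_p(a−b)| ≤ p^{1/2−κ}√(#A#B))`.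

So, in kernel: `stub_paleyFlatRIP` ⟹ Paley-graph flat discrepancy beyond `√p` (this file with
`paleySumDiscrepancy_of_flatRIP`), and conversely Paley-graph flat discrepancy ⟹ Paley-sum flat
discrepancy ⟹ the engine (`flatRIP_of_paleySumDiscrepancy`, file `…FlatOfDiscrepancy.lean`).

Honest framing: equivalences between OPEN statements; the crux `FeketeSOSHard`, the engine and
`stub_tameReduction` remain open; nothing here bears on `VP ≠ VNP`.
-/

-- the line's namespace repeats a path segment by convention (same as the other paley-rip files)
set_option linter.dupNamespace false

namespace Summit.ValiantsHypothesis.ValiantsHypothesis.Theorems.FeketeSOSHardPaleyRIP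

open Finset
open scoped BigOperators

noncomputable section

section DiffSum

variable (p : ℕ) [Fact p.Prime]

/-- Reflection `b ↦ (p − b) mod p` turns `χ_p(a − ·)` into `χ_p(a + ·)`. [folklore] -/
theorem legendreSym_sub_reflect (a b : ℕ) (hb : b < p) :
    legendreSym p ((a : ℤ) - (((p - b) % p : ℕ) : ℤ)) = legendreSym p ((a : ℤ) + b) := by
  unfold legendreSym
  congr 1
  simp only [Int.cast_sub, Int.cast_add, Int.cast_natCast, ZMod.natCast_mod]
  rw [Nat.cast_sub hb.le, ZMod.natCast_self]
  ring

/-- **Reflection identity, read backwards.** `Σ_{a∈A} Σ_{b'∈−B} χ_p(a−b') = Σ_{a∈A} Σ_{b∈B} χ_p(a+b)` for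
`B ⊆ [0,p)`. [folklore] -/
theorem charSum_reflect' (A B : Finset ℕ) (hB : ∀ b ∈ B, b < p) :
    ∑ a ∈ A, ∑ b' ∈ B.image (fun b : ℕ => (p - b) % p), ((legendreSym p ((a : ℤ) - b') : ℤ) : ℂ) =
      ∑ a ∈ A, ∑ b ∈ B, ((legendreSym p ((a : ℤ) + b) : ℤ) : ℂ) := by
  refine sum_congr rfl fun a _ => ?_
  rw [sum_image (reflect_injOn p B hB)]
  refine sum_congr rfl fun b hb => ?_
  rw [legendreSym_sub_reflect p a b (hB b hb)]

end DiffSum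

section Equivalence

/-- **Flat Paley-SUM discrepancy ⟺ flat Paley-GRAPH (difference) discrepancy beyond `√p`**, with the same
exponents: both directions are the reflection `B ↦ −B` (`charSum_reflect`, `charSum_reflect'`), which
preserves `#B` and `B ⊆ [0,p)`. [folklore] -/
theorem paleySumDiscrepancy_iff_paleyDiffDiscrepancy :
    (∃ κ : ℝ, 0 < κ ∧ ∃ δ : ℝ, 0 < δ ∧ ∃ p₁ : ℕ, ∀ (p : ℕ) [Fact p.Prime], p₁ ≤ p →
      ∀ (A B : Finset ℕ), (∀ a ∈ A, a < p) → (∀ b ∈ B, b < p) →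
        (A.card : ℝ) ≤ (p : ℝ) ^ (1 / 2 + δ) → (B.card : ℝ) ≤ (p : ℝ) ^ (1 / 2 + δ) →
        ‖∑ a ∈ A, ∑ b ∈ B, ((legendreSym p ((a : ℤ) + b) : ℤ) : ℂ)‖ ≤
          (p : ℝ) ^ (1 / 2 - κ) * Real.sqrt ((A.card : ℝ) * B.card)) ↔
    (∃ κ : ℝ, 0 < κ ∧ ∃ δ : ℝ, 0 < δ ∧ ∃ p₁ : ℕ, ∀ (p : ℕ) [Fact p.Prime], p₁ ≤ p →
      ∀ (A B : Finset ℕ), (∀ a ∈ A, a < p) → (∀ b ∈ B, b < p) →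
        (A.card : ℝ) ≤ (p : ℝ) ^ (1 / 2 + δ) → (B.card : ℝ) ≤ (p : ℝ) ^ (1 / 2 + δ) →
        ‖∑ a ∈ A, ∑ b ∈ B, ((legendreSym p ((a : ℤ) - b) : ℤ) : ℂ)‖ ≤
          (p : ℝ) ^ (1 / 2 - κ) * Real.sqrt ((A.card : ℝ) * B.card)) := by
  classical
  constructor
  · rintro ⟨κ, hκ, δ, hδ, p₁, hD⟩
    refine ⟨κ, hκ, δ, hδ, p₁, ?_⟩
    intro p _ hp A B hA hBp hAc hBc
    have h := hD p hp A (B.image (fun b : ℕ => (p - b) % p)) hA (reflect_lt p B)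
      hAc (by rw [card_reflect p B hBp]; exact hBc)
    rwa [charSum_reflect p A B hBp, card_reflect p B hBp] at h
  · rintro ⟨κ, hκ, δ, hδ, p₁, hD⟩
    refine ⟨κ, hκ, δ, hδ, p₁, ?_⟩
    intro p _ hp A B hA hBp hAc hBc
    have h := hD p hp A (B.image (fun b : ℕ => (p - b) % p)) hA (reflect_lt p B)
      hAc (by rw [card_reflect p B hBp]; exact hBc)
    rwa [charSum_reflect' p A B hBp, card_reflect p B hBp] at h

end Equivalence

end

end Summit.ValiantsHypothesis.ValiantsHypothesis.Theorems.FeketeSOSHardPaleyRIP
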